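import Summits.BirchSwinnertonDyer.BirchSwinnertonDyer.Theorems.GenusKolyvaginAtTwoMinimalTwinBSDTwoAnalyticSupplies
import Summits.BirchSwinnertonDyer.BirchSwinnertonDyer.Theorems.GenusKolyvaginAtTwoMinimalTwinBSDTwoSwappedPairOneBitDescent
import Summits.BirchSwinnertonDyer.BirchSwinnertonDyer.Theorems.GenusKolyvaginAtTwoMinimalTwinBSDTwoSwappedPairSilentDescent
import Summits.BirchSwinnertonDyer.BirchSwinnertonDyer.Theorems.GenusKolyvaginAtTwoGenusPrimitiveSupplyAtTwoOfKernels
import HarnessLib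

/-!
# Route `GenusKolyvaginAtTwo`, crux U₂ `MinimalTwinBSDTwo` (stmt-BirchSwinnertonDyer-22985): THE ANALYTIC SUPPLIES ARE LOSSLESS —
# modulo the wall, PRINT and the existence of a Frobenian non-vanishing twist, each consumed cell of U₂ IS its analytic supply

Seat `bsd-line-gk2-p3` g29 (PROVER seat 3/3, cell `bsd-f1-sign2`), `--supports stmt-BirchSwinnertonDyer-22985` (helper; closes nothing).
THEOREMS ONLY (no definition, no named fact, no `sorry`); standard axioms.  **BSD is NOT proved by this file; U₂ / the wall / the supplies are
NOT proved; no item is closed.**  Everything is CONDITIONAL on displayed hypotheses: the four statement-only PRINT facts (GZ, GZK, `hasEntireLFunction_rat`,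
Milne), the sliced rank-zero WALL (S1⁺ / S1⁻, beyond print), `BSD₂` on the cell where stated, and the pure ANALYTIC-EXISTENCE statements below.

THE POINT (planner currency).  This seat's `…AnalyticSupplies` (p773223) re-typed the reversed Heegner-twin supplies of the two cells `closes` consumes as
S2⁻ᵃ / S2⁺ᵃ = «a prime `ℓ` in an explicit Čebotarev-type set with `L(W^{(−ℓ)},1) ≠ 0`» ∧ «the exact 2-adic EXPONENT of `y_K`», and showed
`hTw1 ⟸ S1⁻ + S2⁻ᵃ + PRINT`, `hTw0^{egg,S₃} ⟸ S1⁺ + S2⁺ᵃ + PRINT`.  Here the CONVERSE: granted `BSD₂` on the cell curve `W`, the wall and PRINT, EVERY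
door-open (resp. silent) Heegner prime `ℓ` with `L(W^{(−ℓ)},1) ≠ 0` and EVERY Heegner datum satisfy the exponent clause (the BSD pair pins the exponent:
this seat's `OneBit.twoDivExponent_eq_padicValNat_tamagawa_of_bsdp` / `Silent.twoDivExponent_eq_of_bsdp_silent`, p766822 / p767397), so

  **hTw1 ⟺ S2⁻ᵃ** and **hTw0^{egg,S₃} ⟺ S2⁺ᵃ**, each modulo «sliced wall + PRINT + ANALYTIC EXISTENCE»,

where ANALYTIC EXISTENCE⁻(W) := «∃ prime `ℓ ≡ 7 (8)`, `−ℓ` Heegner for `N_W`, `Sel₂(W) ⊄ strictLocalKer_ℓ`, `L(W^{(−ℓ)},1) ≠ 0`, and SOME Heegner datum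
of conductor `1` with `c ≠ 0`» and ANALYTIC EXISTENCE⁺(W) := «∃ prime `ℓ`, `−ℓ` Heegner (`≠ −3`), cubic rootless mod `ℓ`, `L(W^{(−ℓ)},1) ≠ 0`, a datum».
READING: the supplies carry NO content beyond `BSD₂` on the cell except the Frobenian non-vanishing statement (-an §26.6 / -desc §32 / REF2: Ono–Skinner
1998, Ono 2001 — placement of THEIR Frobenius class against «Heegner, prime frame» open; acq-06572); in particular they are BSD-CONSISTENT exactly when
such twists exist.  Nothing here is progress on BSD.

* §1 `exponent_of_bsdp_of_doorPrime_of_lValue_ne_zero` (Δ < 0 cell, pointwise) · §2 `exponent_of_bsdp_of_silentPrime_of_lValue_ne_zero` (egg cell, pointwise)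
* §3 `hTw1_iff_analyticDoorSupply_of_facts` · `hTw0eggS_iff_analyticSilentSupply_of_facts`.

References: [GrossZagier1986] Thm. I.6.3, V.§2 (2.2); [Milne1972ArithmeticAV] §1 Thm. 1; [MazurRubin2010] Cor. 3.4 (i); [Kramer1981] §2 Props. 3, 6;
[McCallumLMS1991] §5 Lemma 5.1; [Miller2011LMS] Def. 1.1.
-/

set_option autoImplicit false
set_option linter.dupNamespace false -- `Summit.<P>.<Sub>` repeats `BirchSwinnertonDyer` (D-0017)

noncomputable section

open scoped Classical

open WeierstrassCurve NumberField Literature.NumberTheory.EllipticCurves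
  Literature.NumberTheory.EllipticCurves.ModularForms
  Literature.NumberTheory.EllipticCurves.Rank1Residual
  Literature.NumberTheory.EllipticCurves.Rank1Residual.Typed
  Literature.NumberTheory.EllipticCurves.KrizLi2019
  Summit.BirchSwinnertonDyer.Rank1Residual
  Summit.BirchSwinnertonDyer.Rank1Residual.AdditivePotMult
  Summit.BirchSwinnertonDyer.Rank1Residual.F1Sign2
  Summit.BirchSwinnertonDyer.BirchSwinnertonDyer.Rank1Residual
  Summit.BirchSwinnertonDyer.BirchSwinnertonDyer.Theses.GenusKolyvaginAtTwo
  Summit.BirchSwinnertonDyer.BirchSwinnertonDyer.Theorems.CMExactDescent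
  Summit.BirchSwinnertonDyer.BirchSwinnertonDyer.Theorems.GenusExact.TwinSwap
  Summit.BirchSwinnertonDyer.BirchSwinnertonDyer.Theorems.GenusExact.TwinSwap.OneBit
  Summit.BirchSwinnertonDyer.BirchSwinnertonDyer.Theorems.GenusExact.PlusDescent

namespace Summit.BirchSwinnertonDyer.BirchSwinnertonDyer.Theorems.GenusExact.TwinSwap.Ledger.Line25

/-! ## §1 `Δ < 0`: the BSD pair pins the exponent at every door-open Heegner prime with `L(W^{(−ℓ)},1) ≠ 0` -/

/-- **Exponent clause of S2⁻ᵃ from `BSD₂` on the cell** (pointwise).  `W` non-CM globally minimal, `r_an = 1`, `#Sel₂ = 2`, `Δ < 0`, `ord₂ C(W) = 1`,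
with `BSD₂(W)`; `K = ℚ(√−ℓ)` (`ℓ` prime, `d_K = −ℓ` odd `≠ −3`, Heegner, `2` split) with the door open at `ℓ` and `L(W^{(−ℓ)},1) ≠ 0`; ANY datum
`(Dt, β, ι, d₁)` with `c ≠ 0`.  Then **`2^{ord₂ c + 1} ∥ P(1)`**.  Chain: `P(1)` non-torsion (p773223 §1); an exact exponent `M₀` exists (McCallum's
`M₀`, `GenusKoly.exists_exactTwoDivisibility_of_not_isOfFinAddOrder`); the globally minimal twin (Silverman VIII.8.3) has `#Sel₂ = 1` (door, p770370),
`ord₂ C = 2` (prime frame, p767140), `r_an = 0`, is non-CM, `Δ < 0` — so `BSD₂(Wd)` by the wall S1⁻; then `M₀ = ord₂ c + 1` by losslessness (p766822).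
CONDITIONAL on the displayed hypotheses; proves nothing about BSD; closes nothing.
[cite: GrossZagier1986, V.§2 (2.2)] [cite: MazurRubin2010, Cor. 3.4 (i)] [cite: McCallumLMS1991, §5 Lemma 5.1] [cite: Miller2011LMS, Def. 1.1] -/
theorem exponent_of_bsdp_of_doorPrime_of_lValue_ne_zero
    (hGZ : ∀ (N : ℕ) [NeZero N] (W : WeierstrassCurve ℚ) (K : Type) [Field K] [NumberField K], gross_zagier N W K)
    (hGZK : rank_eq_analyticRank_of_analyticRank_le_one) (hmod : hasEntireLFunction_rat)
    (hMilneC : Milne1972.bsdQuotient_baseChange_quadratic_anyModel)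
    (hS1neg : ∀ (W : WeierstrassCurve ℚ) [W.IsElliptic] [W.IsGloballyMinimal],
      ¬ W.HasCM → W.analyticRank = 0 → Nat.card (W.selmerGroup 2) = 1 → W.Δ < 0 → padicValNat 2 W.tamagawaProduct = 2 → BSDp W 2)
    (W : WeierstrassCurve ℚ) [W.IsElliptic] [W.IsGloballyMinimal] [NeZero (W.conductorNorm ℤ)]
    (hcm : ¬ W.HasCM) (hr : W.analyticRank = 1) (hSel : Nat.card (W.selmerGroup 2) = 2) (hΔ : W.Δ < 0)
    (hC1 : padicValNat 2 W.tamagawaProduct = 1) (hBW : BSDp W 2)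
    {K : Type} [Field K] [NumberField K] (hK : IsImaginaryQuadratic K) {ℓ : ℕ} [Fact ℓ.Prime] (hd : NumberField.discr K = -(ℓ : ℤ))
    (hns : ¬ W.selmerGroup 2 ≤ MazurRubin2010.strictLocalKer W ℚ_[ℓ] 2)
    (hodd : Odd (NumberField.discr K)) (h3 : NumberField.discr K ≠ -3) (hH : SatisfiesHeegnerHypothesis (W.conductorNorm ℤ) K)
    (h2K : ((Ideal.span {(2 : ℤ)}).primesOver (𝓞 K)).ncard = 2)
    (hL : (W.quadraticTwist (NumberField.discr K : ℚ)).entireLFunction 1 ≠ 0)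
    (Dt : ModularParametrizationData W (W.conductorNorm ℤ)) (hc0 : Dt.c ≠ 0) (β : ℤ) (ι : K →+* ℂ) (d₁ : KolyvaginHeegnerData Dt β ι 1) :
    (∃ Q : (W.baseChange (ringClassField K ι 1)).toAffine.Point, ((2 ^ (padicValInt 2 Dt.c + 1) : ℕ) : ℤ) • Q = d₁.derivedPoint) ∧
      ¬ ∃ Q : (W.baseChange (ringClassField K ι 1)).toAffine.Point,
        ((2 ^ (padicValInt 2 Dt.c + 1 + 1) : ℕ) : ℤ) • Q = d₁.derivedPoint := by
  have hℓ : ℓ.Prime := Fact.out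
  have hD0 : (NumberField.discr K : ℚ) ≠ 0 := by exact_mod_cast NumberField.discr_ne_zero K
  haveI hEt : (W.quadraticTwist (NumberField.discr K : ℚ)).IsElliptic := W.isElliptic_quadraticTwist hD0
  -- non-torsion from the `L`-value, and McCallum's exact exponent
  have hy : ¬ IsOfFinAddOrder d₁.derivedPoint :=
    not_isOfFinAddOrder_derivedPoint_one_of_rankOne_of_lValue_ne_zero hmod W K (hGZ _ W K) hK hH hr hL d₁
  obtain ⟨M₀, hdiv, hndiv⟩ := GenusKoly.exists_exactTwoDivisibility_of_not_isOfFinAddOrder W hK Dt β ι d₁ hy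
  -- the globally minimal twin: `#Sel₂ = 1` (door), `ord₂ C = 2` (prime frame), `r_an = 0`, non-CM, `Δ < 0`; `BSD₂` by the wall
  obtain ⟨Wd, iE, iM, Cd, hCd⟩ := exists_globallyMinimal_model_twist W hD0
  have hSel1 : Nat.card (Wd.selmerGroup 2) = 1 :=
    Door.natCard_selmerGroup_twin_eq_one_of_not_strict W hΔ hSel hK hodd hH h2K hd Wd ⟨Cd, hCd⟩ hns
  have hsucc := padicValNat_two_tamagawaProduct_twin_eq_succ_of_discr_eq_neg_prime W hK hodd hH hℓ hd hΔ Cd hCd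
  have hcmd : ¬ Wd.HasCM := by
    rw [← hCd, hasCM_iff_of_j_eq (((W.quadraticTwist (NumberField.discr K : ℚ)).variableChange_j Cd).trans (W.j_quadraticTwist hD0))]
    exact hcm
  have hrt : (W.quadraticTwist (NumberField.discr K : ℚ)).analyticRank = 0 :=
    ((W.quadraticTwist (NumberField.discr K : ℚ)).analyticRank_eq_zero_iff_holds (hmod _)).mpr hL
  have hrd : Wd.analyticRank = 0 := by rw [← hCd, analyticRank_smul, hrt]
  have hΔd : Wd.Δ < 0 := (Δ_twin_neg_iff W hD0 Cd hCd).mpr hΔ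
  have hC2 : padicValNat 2 Wd.tamagawaProduct = 2 := by rw [hsucc, hC1]
  have hBd : BSDp Wd 2 := hS1neg Wd hcmd hrd hSel1 hΔd hC2
  -- losslessness: the BSD pair forces `M₀ = ord₂ c + ord₂ C(W) = ord₂ c + 1`
  have hM := twoDivExponent_eq_padicValNat_tamagawa_of_bsdp W K (hGZ _ W K) hGZK hmod hMilneC hr hSel hΔ hK hodd h3 hH Dt hc0 β ι
    d₁ hy hdiv hndiv Wd ⟨Cd, hCd⟩ hSel1 (by rw [hsucc]) hBW hBd
  rw [hC1] at hM
  subst hM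
  exact ⟨hdiv, hndiv⟩

/-! ## §2 The egg cell: the BSD pair pins the exponent at every silent Heegner prime with `L(W^{(−ℓ)},1) ≠ 0` -/

/-- **Exponent clause of S2⁺ᵃ from `BSD₂` on the cell** (pointwise).  `W` non-CM globally minimal, `r_an = 1`, `#Sel₂ = 2`, `C(W)` odd, `ρ̄_{W,2}`
onto, `0 < Δ`, MEETING THE EGG, with `BSD₂(W)`; `K = ℚ(√−ℓ)` (`ℓ` prime, `d_K = −ℓ` odd `≠ −3`, Heegner) with the `2`-division cubic ROOTLESS mod `ℓ` and
`L(W^{(−ℓ)},1) ≠ 0`; ANY datum with `c ≠ 0`.  Then **`2^{ord₂ c} ∥ P(1)`**.  Chain: non-torsion (p773223 §1); exact exponent `M₀`; the globally minimal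
twin is silent (p767915), hence `#Sel₂ = 1` on the egg (p769884), `r_an = 0`, non-CM, `0 < Δ`, `ord₂ C = 0` — `BSD₂(Wd)` by the wall S1⁺; then
`M₀ = ord₂ c` by silent losslessness (p767397).  CONDITIONAL on the displayed hypotheses; proves nothing about BSD; closes nothing.
[cite: GrossZagier1986, V.§2 (2.2)] [cite: Kramer1981, §2 Props. 3, 6] [cite: McCallumLMS1991, §5 Lemma 5.1] [cite: Miller2011LMS, Def. 1.1] -/
theorem exponent_of_bsdp_of_silentPrime_of_lValue_ne_zero
    (hGZ : ∀ (N : ℕ) [NeZero N] (W : WeierstrassCurve ℚ) (K : Type) [Field K] [NumberField K], gross_zagier N W K)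
    (hGZK : rank_eq_analyticRank_of_analyticRank_le_one) (hmod : hasEntireLFunction_rat)
    (hMilneC : Milne1972.bsdQuotient_baseChange_quadratic_anyModel)
    (hS1pos : ∀ (W : WeierstrassCurve ℚ) [W.IsElliptic] [W.IsGloballyMinimal],
      ¬ W.HasCM → W.analyticRank = 0 → Nat.card (W.selmerGroup 2) = 1 → 0 < W.Δ → padicValNat 2 W.tamagawaProduct = 0 → BSDp W 2)
    (W : WeierstrassCurve ℚ) [W.IsElliptic] [W.IsGloballyMinimal] [NeZero (W.conductorNorm ℤ)]
    (hcm : ¬ W.HasCM) (hr : W.analyticRank = 1) (hSel : Nat.card (W.selmerGroup 2) = 2) (hT : Odd W.tamagawaProduct)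
    (hsurj : W.HasSurjectiveModNGaloisRep 2) (hΔ : 0 < W.Δ) (hegg : MeetsEgg W) (hBW : BSDp W 2)
    {K : Type} [Field K] [NumberField K] (hK : IsImaginaryQuadratic K) {ℓ : ℕ} (hℓ : ℓ.Prime) (hd : NumberField.discr K = -(ℓ : ℤ))
    (hnoRoot : ∀ x : ZMod ℓ, 4 * x ^ 3 + ((integralModelInt W).b₂ : ZMod ℓ) * x ^ 2 +
      2 * ((integralModelInt W).b₄ : ZMod ℓ) * x + ((integralModelInt W).b₆ : ZMod ℓ) ≠ 0)
    (hodd : Odd (NumberField.discr K)) (h3 : NumberField.discr K ≠ -3) (hH : SatisfiesHeegnerHypothesis (W.conductorNorm ℤ) K)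
    (hL : (W.quadraticTwist (NumberField.discr K : ℚ)).entireLFunction 1 ≠ 0)
    (Dt : ModularParametrizationData W (W.conductorNorm ℤ)) (hc0 : Dt.c ≠ 0) (β : ℤ) (ι : K →+* ℂ) (d₁ : KolyvaginHeegnerData Dt β ι 1) :
    ∃ M₀ : ℕ, padicValInt 2 Dt.c = M₀ ∧
      (∃ Q : (W.baseChange (ringClassField K ι 1)).toAffine.Point, ((2 ^ M₀ : ℕ) : ℤ) • Q = d₁.derivedPoint) ∧
      (¬ ∃ Q : (W.baseChange (ringClassField K ι 1)).toAffine.Point, ((2 ^ (M₀ + 1) : ℕ) : ℤ) • Q = d₁.derivedPoint) := by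
  have hD0 : (NumberField.discr K : ℚ) ≠ 0 := by exact_mod_cast NumberField.discr_ne_zero K
  haveI hEt : (W.quadraticTwist (NumberField.discr K : ℚ)).IsElliptic := W.isElliptic_quadraticTwist hD0
  have hy : ¬ IsOfFinAddOrder d₁.derivedPoint :=
    not_isOfFinAddOrder_derivedPoint_one_of_rankOne_of_lValue_ne_zero hmod W K (hGZ _ W K) hK hH hr hL d₁
  obtain ⟨M₀, hdiv, hndiv⟩ := GenusKoly.exists_exactTwoDivisibility_of_not_isOfFinAddOrder W hK Dt β ι d₁ hy
  have hrk : W.mordellWeilRank = 1 := by rw [(hGZK W (le_of_eq hr)).1, hr]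
  have hC0 : padicValNat 2 W.tamagawaProduct = 0 :=
    padicValNat.eq_zero_of_not_dvd (Nat.two_dvd_ne_zero.mpr (Nat.odd_iff.mp hT))
  -- the globally minimal twin is silent, `2`-Selmer-trivial on the egg, rank-zero analytic, non-CM, `0 < Δ`; `BSD₂` by the wall
  obtain ⟨Wd, iE, iM, Cd, hCd⟩ := exists_globallyMinimal_model_twist W hD0
  have hSil : padicValNat 2 Wd.tamagawaProduct = padicValNat 2 W.tamagawaProduct :=
    Silent.padicValNat_two_tamagawaProduct_twin_eq_of_discr_eq_neg_prime_of_noRoot W hK hodd hH hℓ hd hnoRoot Cd hCd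
  have hSel1 : Nat.card (Wd.selmerGroup 2) = 1 :=
    Egg.natCard_selmerGroup_twin_eq_one_of_meetsEgg_of_silent W hK hodd hH hΔ hsurj hrk hSel Cd hCd hSil hegg
  have hcmd : ¬ Wd.HasCM := by
    rw [← hCd, hasCM_iff_of_j_eq (((W.quadraticTwist (NumberField.discr K : ℚ)).variableChange_j Cd).trans (W.j_quadraticTwist hD0))]
    exact hcm
  have hrt : (W.quadraticTwist (NumberField.discr K : ℚ)).analyticRank = 0 :=
    ((W.quadraticTwist (NumberField.discr K : ℚ)).analyticRank_eq_zero_iff_holds (hmod _)).mpr hL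
  have hrd : Wd.analyticRank = 0 := by rw [← hCd, analyticRank_smul, hrt]
  have hΔd : 0 < Wd.Δ := (Δ_twin_pos_iff W hD0 Cd hCd).mpr hΔ
  have hC0d : padicValNat 2 Wd.tamagawaProduct = 0 := by rw [hSil, hC0]
  have hBd : BSDp Wd 2 := hS1pos Wd hcmd hrd hSel1 hΔd hC0d
  -- losslessness (silent): the BSD pair forces `M₀ = ord₂ c + ord₂ C(W) = ord₂ c`
  have hM := Silent.twoDivExponent_eq_of_bsdp_silent W K (hGZ _ W K) hGZK hmod hMilneC hr hSel hK hodd h3 hH Dt hc0 β ι d₁ hy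
    hdiv hndiv Wd ⟨Cd, hCd⟩ hSel1 hSil hBW hBd
  rw [hC0, add_zero] at hM
  exact ⟨M₀, hM.symm, hdiv, hndiv⟩

/-! ## §3 The cells ARE their analytic supplies (mod wall + PRINT + analytic existence) -/

/-- **hTw1 ⟺ S2⁻ᵃ, modulo S1⁻ + PRINT + ANALYTIC EXISTENCE⁻.**  `hEx` = for every curve of the cell a prime `ℓ ≡ 7 (8)` with `−ℓ` Heegner, door open,
`L(W^{(−ℓ)},1) ≠ 0`, and some conductor-`1` Heegner datum with `c ≠ 0` (pure Čebotarev + Frobenian non-vanishing + modularity data; beyond print only in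
the non-vanishing).  ⟸ is p773223's `hTw1_of_slicedWall_of_analyticDoorSupply_of_facts`; ⟹ assembles S2⁻ᵃ from the existence data with the exponent
clause of §1.  CONDITIONAL on the displayed hypotheses; proves nothing about BSD; closes nothing.
[cite: GrossZagier1986, V.§2 (2.2)] [cite: MazurRubin2010, Cor. 3.4 (i)] [cite: Miller2011LMS, Def. 1.1] -/
theorem hTw1_iff_analyticDoorSupply_of_facts
    (hGZ : ∀ (N : ℕ) [NeZero N] (W : WeierstrassCurve ℚ) (K : Type) [Field K] [NumberField K], gross_zagier N W K)
    (hGZK : rank_eq_analyticRank_of_analyticRank_le_one) (hmod : hasEntireLFunction_rat)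
    (hMilneC : Milne1972.bsdQuotient_baseChange_quadratic_anyModel)
    (hS1neg : ∀ (W : WeierstrassCurve ℚ) [W.IsElliptic] [W.IsGloballyMinimal],
      ¬ W.HasCM → W.analyticRank = 0 → Nat.card (W.selmerGroup 2) = 1 → W.Δ < 0 → padicValNat 2 W.tamagawaProduct = 2 → BSDp W 2)
    (hEx : ∀ (W : WeierstrassCurve ℚ) [W.IsElliptic] [W.IsGloballyMinimal] [NeZero (W.conductorNorm ℤ)],
      ¬ W.HasCM → W.analyticRank = 1 → Nat.card (W.selmerGroup 2) = 2 → W.Δ < 0 → padicValNat 2 W.tamagawaProduct = 1 →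
      ∃ (K : Type) (_ : Field K) (_ : NumberField K),
        IsImaginaryQuadratic K ∧
        (∃ (ℓ : ℕ) (_ : Fact ℓ.Prime), NumberField.discr K = -(ℓ : ℤ) ∧
          ¬ W.selmerGroup 2 ≤ MazurRubin2010.strictLocalKer W ℚ_[ℓ] 2) ∧
        Odd (NumberField.discr K) ∧ NumberField.discr K ≠ -3 ∧ SatisfiesHeegnerHypothesis (W.conductorNorm ℤ) K ∧
        ((Ideal.span {(2 : ℤ)}).primesOver (𝓞 K)).ncard = 2 ∧
        (W.quadraticTwist (NumberField.discr K : ℚ)).entireLFunction 1 ≠ 0 ∧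
        ∃ (Dt : ModularParametrizationData W (W.conductorNorm ℤ)) (β : ℤ) (ι : K →+* ℂ) (_ : KolyvaginHeegnerData Dt β ι 1),
          Dt.c ≠ 0) :
    (∀ (W : WeierstrassCurve ℚ) [W.IsElliptic] [W.IsGloballyMinimal], ¬ W.HasCM → W.analyticRank = 1 →
      Nat.card (W.selmerGroup 2) = 2 → W.Δ < 0 → padicValNat 2 W.tamagawaProduct = 1 → BSDp W 2) ↔
    (∀ (W : WeierstrassCurve ℚ) [W.IsElliptic] [W.IsGloballyMinimal] [NeZero (W.conductorNorm ℤ)],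
      ¬ W.HasCM → W.analyticRank = 1 → Nat.card (W.selmerGroup 2) = 2 → W.Δ < 0 → padicValNat 2 W.tamagawaProduct = 1 →
      ∃ (K : Type) (_ : Field K) (_ : NumberField K),
        IsImaginaryQuadratic K ∧
        (∃ (ℓ : ℕ) (_ : Fact ℓ.Prime), NumberField.discr K = -(ℓ : ℤ) ∧
          ¬ W.selmerGroup 2 ≤ MazurRubin2010.strictLocalKer W ℚ_[ℓ] 2) ∧
        Odd (NumberField.discr K) ∧ NumberField.discr K ≠ -3 ∧ SatisfiesHeegnerHypothesis (W.conductorNorm ℤ) K ∧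
        ((Ideal.span {(2 : ℤ)}).primesOver (𝓞 K)).ncard = 2 ∧
        (W.quadraticTwist (NumberField.discr K : ℚ)).entireLFunction 1 ≠ 0 ∧
        ∃ (Dt : ModularParametrizationData W (W.conductorNorm ℤ)) (β : ℤ) (ι : K →+* ℂ) (d₁ : KolyvaginHeegnerData Dt β ι 1),
          Dt.c ≠ 0 ∧
          (∃ Q : (W.baseChange (ringClassField K ι 1)).toAffine.Point,
            ((2 ^ (padicValInt 2 Dt.c + 1) : ℕ) : ℤ) • Q = d₁.derivedPoint) ∧
          (¬ ∃ Q : (W.baseChange (ringClassField K ι 1)).toAffine.Point,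
            ((2 ^ (padicValInt 2 Dt.c + 1 + 1) : ℕ) : ℤ) • Q = d₁.derivedPoint)) := by
  refine ⟨fun hTw1 W _ _ _ hcm hr hSel hΔ hC1 ↦ ?_, fun h ↦ hTw1_of_slicedWall_of_analyticDoorSupply_of_facts hGZ hGZK hmod hMilneC hS1neg h⟩
  have hBW : BSDp W 2 := hTw1 W hcm hr hSel hΔ hC1
  obtain ⟨K, iF, iN, hK, ⟨ℓ, iℓ, hd, hns⟩, hodd, h3, hH, h2K, hL, Dt, β, ι, d₁, hc0⟩ := hEx W hcm hr hSel hΔ hC1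
  obtain ⟨hdiv, hndiv⟩ := exponent_of_bsdp_of_doorPrime_of_lValue_ne_zero hGZ hGZK hmod hMilneC hS1neg W hcm hr hSel hΔ hC1 hBW hK hd
    hns hodd h3 hH h2K hL Dt hc0 β ι d₁
  exact ⟨K, iF, iN, hK, ⟨ℓ, iℓ, hd, hns⟩, hodd, h3, hH, h2K, hL, Dt, β, ι, d₁, hc0, hdiv, hndiv⟩

/-- **hTw0^{egg,S₃} ⟺ S2⁺ᵃ, modulo S1⁺ + PRINT + ANALYTIC EXISTENCE⁺.**  `hEx` = for every curve of the egg cell a prime `ℓ` with `−ℓ` Heegner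
(`d_K ≠ −3`), cubic rootless mod `ℓ`, `L(W^{(−ℓ)},1) ≠ 0`, and some conductor-`1` datum with `c ≠ 0`.  ⟸ is p773223's
`hTw0eggS_of_slicedWall_of_analyticSilentSupply_of_facts`; ⟹ assembles S2⁺ᵃ with the exponent clause of §2.  CONDITIONAL on the displayed hypotheses;
proves nothing about BSD; closes nothing.  [cite: Kramer1981, §2 Props. 3, 6] [cite: GrossZagier1986, V.§2 (2.2)] [cite: Miller2011LMS, Def. 1.1] -/
theorem hTw0eggS_iff_analyticSilentSupply_of_facts
    (hGZ : ∀ (N : ℕ) [NeZero N] (W : WeierstrassCurve ℚ) (K : Type) [Field K] [NumberField K], gross_zagier N W K)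
    (hGZK : rank_eq_analyticRank_of_analyticRank_le_one) (hmod : hasEntireLFunction_rat)
    (hMilneC : Milne1972.bsdQuotient_baseChange_quadratic_anyModel)
    (hS1pos : ∀ (W : WeierstrassCurve ℚ) [W.IsElliptic] [W.IsGloballyMinimal],
      ¬ W.HasCM → W.analyticRank = 0 → Nat.card (W.selmerGroup 2) = 1 → 0 < W.Δ → padicValNat 2 W.tamagawaProduct = 0 → BSDp W 2)
    (hEx : ∀ (W : WeierstrassCurve ℚ) [W.IsElliptic] [W.IsGloballyMinimal] [NeZero (W.conductorNorm ℤ)],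
      ¬ W.HasCM → W.analyticRank = 1 → Nat.card (W.selmerGroup 2) = 2 → Odd W.tamagawaProduct → W.HasSurjectiveModNGaloisRep 2 →
      0 < W.Δ → MeetsEgg W →
      ∃ (K : Type) (_ : Field K) (_ : NumberField K),
        IsImaginaryQuadratic K ∧
        (∃ ℓ : ℕ, ℓ.Prime ∧ NumberField.discr K = -(ℓ : ℤ) ∧
          ∀ x : ZMod ℓ, 4 * x ^ 3 + ((integralModelInt W).b₂ : ZMod ℓ) * x ^ 2 +
            2 * ((integralModelInt W).b₄ : ZMod ℓ) * x + ((integralModelInt W).b₆ : ZMod ℓ) ≠ 0) ∧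
        Odd (NumberField.discr K) ∧ NumberField.discr K ≠ -3 ∧ SatisfiesHeegnerHypothesis (W.conductorNorm ℤ) K ∧
        (W.quadraticTwist (NumberField.discr K : ℚ)).entireLFunction 1 ≠ 0 ∧
        ∃ (Dt : ModularParametrizationData W (W.conductorNorm ℤ)) (β : ℤ) (ι : K →+* ℂ) (_ : KolyvaginHeegnerData Dt β ι 1),
          Dt.c ≠ 0) :
    (∀ (W : WeierstrassCurve ℚ) [W.IsElliptic] [W.IsGloballyMinimal], ¬ W.HasCM → W.analyticRank = 1 →
      Nat.card (W.selmerGroup 2) = 2 → W.HasSurjectiveModNGaloisRep 2 → 0 < W.Δ → padicValNat 2 W.tamagawaProduct = 0 →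
      MeetsEgg W → BSDp W 2) ↔
    (∀ (W : WeierstrassCurve ℚ) [W.IsElliptic] [W.IsGloballyMinimal] [NeZero (W.conductorNorm ℤ)],
      ¬ W.HasCM → W.analyticRank = 1 → Nat.card (W.selmerGroup 2) = 2 → Odd W.tamagawaProduct → W.HasSurjectiveModNGaloisRep 2 →
      0 < W.Δ → MeetsEgg W →
      ∃ (K : Type) (_ : Field K) (_ : NumberField K),
        IsImaginaryQuadratic K ∧
        (∃ ℓ : ℕ, ℓ.Prime ∧ NumberField.discr K = -(ℓ : ℤ) ∧
          ∀ x : ZMod ℓ, 4 * x ^ 3 + ((integralModelInt W).b₂ : ZMod ℓ) * x ^ 2 +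
            2 * ((integralModelInt W).b₄ : ZMod ℓ) * x + ((integralModelInt W).b₆ : ZMod ℓ) ≠ 0) ∧
        Odd (NumberField.discr K) ∧ NumberField.discr K ≠ -3 ∧ SatisfiesHeegnerHypothesis (W.conductorNorm ℤ) K ∧
        (W.quadraticTwist (NumberField.discr K : ℚ)).entireLFunction 1 ≠ 0 ∧
        ∃ (Dt : ModularParametrizationData W (W.conductorNorm ℤ)) (β : ℤ) (ι : K →+* ℂ) (d₁ : KolyvaginHeegnerData Dt β ι 1),
          Dt.c ≠ 0 ∧
          (∃ M₀ : ℕ, padicValInt 2 Dt.c = M₀ ∧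
            (∃ Q : (W.baseChange (ringClassField K ι 1)).toAffine.Point, ((2 ^ M₀ : ℕ) : ℤ) • Q = d₁.derivedPoint) ∧
            (¬ ∃ Q : (W.baseChange (ringClassField K ι 1)).toAffine.Point, ((2 ^ (M₀ + 1) : ℕ) : ℤ) • Q = d₁.derivedPoint))) := by
  refine ⟨fun hTw0 W _ _ _ hcm hr hSel hT hsurj hΔ hegg ↦ ?_,
    fun h ↦ hTw0eggS_of_slicedWall_of_analyticSilentSupply_of_facts hGZ hGZK hmod hMilneC hS1pos h⟩
  have hC0 : padicValNat 2 W.tamagawaProduct = 0 :=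
    padicValNat.eq_zero_of_not_dvd (Nat.two_dvd_ne_zero.mpr (Nat.odd_iff.mp hT))
  have hBW : BSDp W 2 := hTw0 W hcm hr hSel hsurj hΔ hC0 hegg
  obtain ⟨K, iF, iN, hK, ⟨ℓ, hℓ, hd, hnoRoot⟩, hodd, h3, hH, hL, Dt, β, ι, d₁, hc0⟩ := hEx W hcm hr hSel hT hsurj hΔ hegg
  have hexp := exponent_of_bsdp_of_silentPrime_of_lValue_ne_zero hGZ hGZK hmod hMilneC hS1pos W hcm hr hSel hT hsurj hΔ hegg hBW hK hℓ
    hd hnoRoot hodd h3 hH hL Dt hc0 β ι d₁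
  exact ⟨K, iF, iN, hK, ⟨ℓ, hℓ, hd, hnoRoot⟩, hodd, h3, hH, hL, Dt, β, ι, d₁, hc0, hexp⟩

end Summit.BirchSwinnertonDyer.BirchSwinnertonDyer.Theorems.GenusExact.TwinSwap.Ledger.Line25

end
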